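import Summits.BirchSwinnertonDyer.BirchSwinnertonDyer.Theorems.PrintCf2SplitBadTwoUpperBaseLiftLayers
import Literature.NumberTheory.EllipticCurves.SelmerCorankProofs
import Literature.NumberTheory.EllipticCurves.IwasawaSelmerDualProofs
import HarnessLib

/-!
# Crux `PrintCf2.SplitBadTwoRankOneOfFacts` (stmt-BirchSwinnertonDyer-20368), skeleton v13.1, stub S3n′ `stub_pseudoNullFinite_two`,
# S3N-FACTFREE brick B3 of -w5 g7's R2 map («LEVELS → DIVISIBLE `A`»): the generic Kummer lift `H¹(G, A[n]) ↠ H¹(G, A)[n]`, coefficient-change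
# bookkeeping, and the glue «(SUR_U) for torsion-bounded target families, every exponent ⟹ (SUR_U)»

Cell `bsd-print-cf2`, EXTRA WIDTH seat `bsd-line-cf2-p1-w4` g12 (prover-bsd-line-cf2-p1-w4-g12-0); `--supports stmt-BirchSwinnertonDyer-20368`
(helper, Theses-free). HONEST FRAMING: nothing here closes the crux or a registered stub; BSD is not proved by any of this; no summit statement
is proved by this seat. No definition, no named fact, no `sorry`.

WHY. The limit step p700059 `locSurj_of_layers` consumes (SUR_U) = (LSₙ) at the open layers `U = κ₂.layerSubgroup n` with DIVISIBLE coefficients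
`A` (`A_θ`, `W*`); -w5 g7's R2 engine (p700098 `ProNullLift…`, memo `R2-BRICKS-w5g7.md`) produces it at FINITE coefficient levels `A[p^k] ↪ A[p^m]`
under (PRO-NULL). This file is the level-free half of the passage (brick B3, marked FREE in the memo):
* §1 **`exists_resH1Hom_id_eq_of_nsmul_eq_zero`** — GENERIC KUMMER LIFT: for a topological group `G`, a discrete `G`-module `A` with continuous orbit
  maps, `n`-DIVISIBLE, and an injective equivariant `ι : N →+ A` whose range contains `A[n]`, every class `x ∈ H¹(G, A)` with `n • x = 0` is `ι_* y`
  (`p^J φ = ∂a`, `a = n b`, `φ − ∂b` takes values in `A[n]`; the tree's curve-specific `exists_torsionPowToPrimaryH1Sub_eq` made curve-free);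
* §2 `resH1Hom_comp_resH1Hom_id`, `conjH1_comp_resH1Hom_id` — the coefficient push `ι_* = resH1Hom id ι` commutes with every restriction along a group
  map (`resOfLe`, `decompInToH`, `inertiaInToH`) and with `conjH1`;
* §3 **`locSurj_of_forall_torsionExponent`** — for an open layer (any subgroup `U`, finitely many places of `K̄^U` above each relevant `w`): if (SUR_U)
  holds for every family of targets killed by `p^k`, for every `k`, then (SUR_U) holds (every target class is `p^k`-torsion for some `k` —
  compactness of `U ∩ D_w`, `IwasawaDual.exists_pow_smul_oneCocycleClass_eq_zero` — and finitely many targets have a common exponent);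
  `locSurj_layerSubgroup_of_forall_torsionExponent` — the same at `U = κ.layerSubgroup n` with the finiteness DERIVED from «`¬ D_w ≤ ker κ`»
  (-w8 g4 `LineDoubleCoset.finite_doubleCosetQuotient_layerSubgroup`), i.e. exactly the `hLSn n` input of p700059.
So the supplier's remaining statement is (SUR_U)ₖ: targets `τ w q ∈ H¹(U ∩ D_w, A)` with `p^k • τ w q = 0` (⟸ §1: `τ w q = ι_* τ̃`, `τ̃ ∈ H¹(U ∩ D_w, A[p^k])`)
are hit modulo unramified classes by some `z ∈ H¹(U, A)` unramified elsewhere — B2's output pushed to `A` by `ι_{m,*}` (§2 keeps the matching).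
presearch: Greenberg LNM 1716 §5 p. 114 (Kummer lift); GV 2000 §2 Prop. 2.1; held; tree pattern `SelmerInftyTorsionPowKummerLiftProofs`. No new fact.
beyond-print theorem: no.

References: [GreenbergLNM1716] §5 p. 114, §4 Props. 4.13–4.15; [GreenbergVatsal2000] §2 Prop. 2.1; [SerreGaloisCohomology1997] I §2.2, I §5.1.
-/

noncomputable section

open scoped Classical

set_option linter.dupNamespace false
set_option autoImplicit false

open NumberField IsDedekindDomain Field
open Literature.NumberTheory.EllipticCurves Literature.NumberTheory.EllipticCurves.GreenbergSelmer
open Literature.NumberTheory.EllipticCurves.GreenbergVatsal2000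
open Literature.NumberTheory.GaloisRepresentations
open Summit.BirchSwinnertonDyer.Rank1Residual.X11b

namespace Summit.BirchSwinnertonDyer.BirchSwinnertonDyer.Theorems.PrintCf2.UpperBaseLift

universe u

/-! ## §1. The generic Kummer lift `H¹(G, A[n]) ↠ H¹(G, A)[n]` -/

section KummerLift

variable {G : Type u} [Group G] [TopologicalSpace G] [IsTopologicalGroup G]
  {A : Type u} [AddCommGroup A] [DistribMulAction G A] [TopologicalSpace A] [DiscreteTopology A]
  {N : Type u} [AddCommGroup N] [DistribMulAction G N] [TopologicalSpace N] [DiscreteTopology N]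

/-- **GENERIC KUMMER LIFT `H¹(G, A[n]) ↠ H¹(G, A)[n]`.** Let `A` be a discrete `G`-module with continuous orbit maps which is `n`-divisible, and
`ι : N →+ A` an injective equivariant map whose range contains `A[n]`. Then every `x ∈ H¹(G, A)` with `n • x = 0` is `ι_* y` for some `y ∈ H¹(G, N)`:
`n φ = ∂a` (`oneCocycleClass_eq_zero_iff`), `a = n b`, and `φ − ∂b` takes values in `A[n] ⊆ ι(N)` (`contOneCocycles.lift`). The curve-free form of
the tree's `WeierstrassCurve.exists_torsionPowToPrimaryH1Sub_eq`. [cite: GreenbergLNM1716, §5 p. 114] [cite: SerreGaloisCohomology1997, I §5.1] -/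
theorem exists_resH1Hom_id_eq_of_nsmul_eq_zero (ι : N →+ A) (hι : ∀ (g : G) (s : N), ι (ContinuousMonoidHom.id G g • s) = g • ι s)
    (hinj : Function.Injective ι) (n : ℕ) (hrange : ∀ a : A, n • a = 0 → a ∈ ι.range) (hdiv : ∀ a : A, ∃ b : A, n • b = a)
    (hcont : ∀ a : A, Continuous fun g : G ↦ g • a) {x : discreteH1 G A} (hx : n • x = 0) :
    ∃ y : discreteH1 G N, resH1Hom (ContinuousMonoidHom.id G) ι hι y = x := by
  obtain ⟨φ, rfl⟩ := oneCocycleClass_surjective _ x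
  have h := oneCocycleClass_smul (discreteTopRep G A) (n : ℤ) φ
  conv at h => rhs; rw [Nat.cast_smul_eq_nsmul, hx]
  obtain ⟨a, ha⟩ := (oneCocycleClass_eq_zero_iff _ _).mp h
  have ha' : ∀ g : G, n • φ.1 g = g • a - a := fun g ↦ by
    rw [← natCast_zsmul]
    exact ha g
  obtain ⟨b, rfl⟩ := hdiv a
  set φ' := φ - cobCocycle b (hcont b) with hφ'
  have hval : ∀ g : G, n • φ'.1 g = 0 := fun g ↦ by
    change n • (φ.1 g - (g • b - b)) = 0
    rw [smul_sub, ha', smul_sub, smul_comm, sub_self]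
  have hmem : ∀ g : G, φ'.1 g ∈ ι.range := fun g ↦ hrange _ (hval g)
  choose s hs using hmem
  let χ : contOneCocycles (discreteTopRep G N) := contOneCocycles.lift ι hι hinj φ' s hs
  refine ⟨oneCocycleClass _ χ, ?_⟩
  rw [resH1Hom_id_oneCocycleClass, contOneCocycles.push_lift, hφ', oneCocycleClass_sub, oneCocycleClass_cobCocycle, sub_zero]

end KummerLift

/-! ## §2. The coefficient push commutes with restriction and conjugation -/

section Coeff

variable {G : Type u} [Group G] [TopologicalSpace G] [IsTopologicalGroup G]
  {G' : Type u} [Group G'] [TopologicalSpace G'] [IsTopologicalGroup G']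
  {A : Type u} [AddCommGroup A] [DistribMulAction G A] [TopologicalSpace A] [DiscreteTopology A]
  {N : Type u} [AddCommGroup N] [DistribMulAction G N] [TopologicalSpace N] [DiscreteTopology N]

/-- **Restriction along a group map commutes with the coefficient push**: for `θ : G' → G` and an equivariant `ι : N →+ A` (restricted modules on
`G'`), `res_θ ∘ ι_* = ι_* ∘ res_θ` — both are the map of the compatible pair `(θ, ι)`. Covers `resOfLe`, `decompInToH`, `inertiaInToH`.
[cite: SerreGaloisCohomology1997, I §2.4] -/
theorem resH1Hom_comp_resH1Hom_id {A' N' : Type u} [AddCommGroup A'] [DistribMulAction G' A'] [TopologicalSpace A'] [DiscreteTopology A']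
    [AddCommGroup N'] [DistribMulAction G' N'] [TopologicalSpace N'] [DiscreteTopology N'] (θ : G' →ₜ* G)
    (ι : N →+ A) (hι : ∀ (g : G) (s : N), ι (ContinuousMonoidHom.id G g • s) = g • ι s)
    (ι' : N' →+ A') (hι' : ∀ (g : G') (s : N'), ι' (ContinuousMonoidHom.id G' g • s) = g • ι' s)
    (rA : A →+ A') (hrA : ∀ (x : G') (m : A), rA (θ x • m) = x • rA m) (rN : N →+ N') (hrN : ∀ (x : G') (m : N), rN (θ x • m) = x • rN m)
    (hsq : ∀ s : N, rA (ι s) = ι' (rN s)) :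
    (resH1Hom θ rA hrA).comp (resH1Hom (ContinuousMonoidHom.id G) ι hι) =
      (resH1Hom (ContinuousMonoidHom.id G') ι' hι').comp (resH1Hom θ rN hrN) := by
  rw [resH1Hom_comp, resH1Hom_comp]
  exact resH1Hom_congr (ContinuousMonoidHom.ext fun _ ↦ rfl) (AddMonoidHom.ext fun s ↦ hsq s) _ _

/-- **Conjugation commutes with the coefficient push** on `H¹(H, ·)` for a normal subgroup `H ≤ G` and an equivariant `ι : N →+ A`:
`conj_σ ∘ ι_* = ι_* ∘ conj_σ`. [cite: NeukirchSchmidtWingberg2008, I.§5] -/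
theorem conjH1_comp_resH1Hom_id (H : Subgroup G) [H.Normal] (ι : N →+ A) (hιG : ∀ (g : G) (s : N), ι (g • s) = g • ι s) (σ : G) :
    (conjH1 H A σ).comp (resH1Hom (ContinuousMonoidHom.id H) ι (fun g s ↦ hιG (g : G) s)) =
      (resH1Hom (ContinuousMonoidHom.id H) ι (fun g s ↦ hιG (g : G) s)).comp (conjH1 H N σ) := by
  rw [conjH1, conjH1, resH1Hom_comp, resH1Hom_comp]
  exact resH1Hom_congr (ContinuousMonoidHom.ext fun _ ↦ rfl) (AddMonoidHom.ext fun s ↦ (hιG σ s).symm) _ _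

end Coeff

/-! ## §3. (SUR_U) from its torsion-bounded instances -/

section Glue

variable {K : Type} [Field K] [NumberField K] {p : ℕ} [Fact p.Prime] (U : Subgroup (absoluteGaloisGroup K)) [U.Normal]
  (M : Type) [AddCommGroup M] [DistribMulAction (absoluteGaloisGroup K) M] [TopologicalSpace M] [DiscreteTopology M]
  {vbar : HeightOneSpectrum (𝓞 K)}

omit [Fact p.Prime] [U.Normal] in
/-- **Every class of `H¹(U ∩ D_w, M)` is killed by a power of `p`** (`U` closed, `M` `p`-primary: the cocycle has finitely many values on the compact
group `U ∩ D_w`). [cite: GreenbergLNM1716, §1 (after Conj. 1.3)] -/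
theorem exists_pow_smul_subgroupH1_decompIn_eq_zero (hU : IsClosed (U : Set (absoluteGaloisGroup K)))
    (htor : ∀ m : M, ∃ k : ℕ, p ^ k • m = 0) (w : HeightOneSpectrum (𝓞 K)) (c : subgroupH1 (decompIn U w) M) :
    ∃ k : ℕ, p ^ k • c = 0 := by
  haveI : CompactSpace (absoluteGaloisGroup K) := absoluteGaloisGroup_compactSpace K
  haveI : CompactSpace (decomp (K := K) w) := isCompact_iff_compactSpace.mp (Coinv.isClosed_decomp w).isCompact
  have hcl : IsClosed ((decompIn U w : Subgroup (decomp (K := K) w)) : Set (decomp (K := K) w)) := by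
    have e : ((decompIn U w : Subgroup (decomp (K := K) w)) : Set (decomp (K := K) w)) = Subtype.val ⁻¹' (U : Set (absoluteGaloisGroup K)) := by
      ext d
      exact mem_decompIn_iff U w d
    rw [e]
    exact hU.preimage continuous_subtype_val
  haveI : CompactSpace (decompIn U w) := isCompact_iff_compactSpace.mp hcl.isCompact
  obtain ⟨φ, rfl⟩ := oneCocycleClass_surjective _ c
  exact IwasawaDual.exists_pow_smul_oneCocycleClass_eq_zero φ fun σ ↦ htor (φ.1 σ)

omit [Fact p.Prime] in
/-- **(SUR_U) from its TORSION-BOUNDED instances.** For a closed normal `U ≤ Γ_K` with finitely many places of `K̄^U` above every `w ∤ p` and above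
`v̄` (`Finite (D_w \ Γ_K / U)`) and a `p`-primary `M`: if for every exponent `k` the local surjectivity (SUR_U) holds for all target families killed by
`p^k`, then (SUR_U) holds — the finitely many targets above the finite set `T` have a common exponent. (SUR_U) is VERBATIM the `hLSn n` input of p700059
`locSurj_of_layers` at `U = κ.layerSubgroup n`. [cite: GreenbergVatsal2000, §2 Prop. 2.1] [cite: GreenbergLNM1716, §4 Props. 4.13–4.15] -/
theorem locSurj_of_forall_torsionExponent (hU : IsClosed (U : Set (absoluteGaloisGroup K))) (htor : ∀ m : M, ∃ k : ℕ, p ^ k • m = 0)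
    (hfin : ∀ w : HeightOneSpectrum (𝓞 K), (((p : ℕ) : 𝓞 K) ∉ w.asIdeal ∨ w = vbar) →
      Finite (DoubleCoset.Quotient (decomp (K := K) w : Set (absoluteGaloisGroup K)) (U : Set (absoluteGaloisGroup K))))
    (hLSk : ∀ (k : ℕ) (T : Finset (HeightOneSpectrum (𝓞 K))), (∀ w ∈ T, ((p : ℕ) : 𝓞 K) ∉ w.asIdeal ∨ w = vbar) →
      ∀ τ : (w : HeightOneSpectrum (𝓞 K)) →
        DoubleCoset.Quotient (decomp (K := K) w : Set (absoluteGaloisGroup K)) (U : Set (absoluteGaloisGroup K)) → subgroupH1 (decompIn U w) M,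
      (∀ w ∈ T, ∀ q, p ^ k • τ w q = 0) →
      ∃ z : subgroupH1 U M,
        (∀ w ∈ T, ∀ q : DoubleCoset.Quotient (decomp (K := K) w : Set (absoluteGaloisGroup K)) (U : Set (absoluteGaloisGroup K)),
          resOfLe M (inertiaIn_le_decompIn U w)
            (resH1Hom (decompInToH U w) (AddMonoidHom.id M) (fun _ _ ↦ rfl) (conjH1 U M q.out z) - τ w q) = 0) ∧
        (∀ w : HeightOneSpectrum (𝓞 K), w ∉ T → (((p : ℕ) : 𝓞 K) ∉ w.asIdeal ∨ w = vbar) →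
          ∀ σ : absoluteGaloisGroup K, conjH1 U M σ z ∈ unramifiedKer U M w)) :
    ∀ (T : Finset (HeightOneSpectrum (𝓞 K))), (∀ w ∈ T, ((p : ℕ) : 𝓞 K) ∉ w.asIdeal ∨ w = vbar) →
      ∀ τ : (w : HeightOneSpectrum (𝓞 K)) →
        DoubleCoset.Quotient (decomp (K := K) w : Set (absoluteGaloisGroup K)) (U : Set (absoluteGaloisGroup K)) → subgroupH1 (decompIn U w) M,
      ∃ z : subgroupH1 U M,
        (∀ w ∈ T, ∀ q : DoubleCoset.Quotient (decomp (K := K) w : Set (absoluteGaloisGroup K)) (U : Set (absoluteGaloisGroup K)),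
          resOfLe M (inertiaIn_le_decompIn U w)
            (resH1Hom (decompInToH U w) (AddMonoidHom.id M) (fun _ _ ↦ rfl) (conjH1 U M q.out z) - τ w q) = 0) ∧
        (∀ w : HeightOneSpectrum (𝓞 K), w ∉ T → (((p : ℕ) : 𝓞 K) ∉ w.asIdeal ∨ w = vbar) →
          ∀ σ : absoluteGaloisGroup K, conjH1 U M σ z ∈ unramifiedKer U M w) := by
  intro T hT τ
  -- a common exponent for the finitely many targets above `T`
  have hk : ∀ (w : HeightOneSpectrum (𝓞 K)) (q : DoubleCoset.Quotient (decomp (K := K) w : Set (absoluteGaloisGroup K)) (U : Set (absoluteGaloisGroup K))),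
      ∃ k : ℕ, p ^ k • τ w q = 0 := fun w q ↦ exists_pow_smul_subgroupH1_decompIn_eq_zero U M hU htor w (τ w q)
  choose kOf hkOf using hk
  have hB : ∀ (w : HeightOneSpectrum (𝓞 K)) (hw : ((p : ℕ) : 𝓞 K) ∉ w.asIdeal ∨ w = vbar), ∃ B : ℕ, ∀ q, kOf w q ≤ B := by
    intro w hw
    haveI := hfin w hw
    exact Finite.exists_le (kOf w)
  choose Bof hBof using hB
  set B' : HeightOneSpectrum (𝓞 K) → ℕ := fun w ↦ if h : (((p : ℕ) : 𝓞 K) ∉ w.asIdeal ∨ w = vbar) then Bof w h else 0 with hB'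
  set k : ℕ := T.sup B' with hkdef
  have hkT : ∀ (w : HeightOneSpectrum (𝓞 K)) (hwT : w ∈ T) (q), kOf w q ≤ k := by
    intro w hwT q
    have h1 : B' w ≤ k := Finset.le_sup hwT
    have h2 : B' w = Bof w (hT w hwT) := dif_pos (hT w hwT)
    rw [h2] at h1
    exact (hBof w (hT w hwT) q).trans h1
  refine hLSk k T hT τ fun w hwT q ↦ ?_
  obtain ⟨e, he⟩ := Nat.exists_eq_add_of_le (hkT w hwT q)
  rw [he, pow_add, mul_comm, mul_smul, hkOf w q, smul_zero]

variable {U M} in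
/-- **The same at a layer `U = κ.layerSubgroup n` of a `ℤ_p`-extension**, the finiteness of the places of `K_n` above `w` DERIVED from
«`w` does not split completely in `K_∞`» (`¬ D_w ≤ ker κ`; -w8 g4 `LineDoubleCoset.finite_doubleCosetQuotient_layerSubgroup`) — exactly the input
`hLSn n` of p700059 `locSurj_of_layers` from its torsion-bounded instances. [cite: GreenbergVatsal2000, §2 Prop. 2.1] [cite: Washington1997, §13.1] -/
theorem locSurj_layerSubgroup_of_forall_torsionExponent (κ : ZpExtension K p) (n : ℕ) (htor : ∀ m : M, ∃ k : ℕ, p ^ k • m = 0)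
    (hD : ∀ w : HeightOneSpectrum (𝓞 K), (((p : ℕ) : 𝓞 K) ∉ w.asIdeal ∨ w = vbar) → ¬ decomp (K := K) w ≤ κ.kerSubgroup)
    (hLSk : ∀ (k : ℕ) (T : Finset (HeightOneSpectrum (𝓞 K))), (∀ w ∈ T, ((p : ℕ) : 𝓞 K) ∉ w.asIdeal ∨ w = vbar) →
      ∀ τ : (w : HeightOneSpectrum (𝓞 K)) →
        DoubleCoset.Quotient (decomp (K := K) w : Set (absoluteGaloisGroup K)) (κ.layerSubgroup n : Set (absoluteGaloisGroup K)) →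
          subgroupH1 (decompIn (κ.layerSubgroup n) w) M,
      (∀ w ∈ T, ∀ q, p ^ k • τ w q = 0) →
      ∃ z : subgroupH1 (κ.layerSubgroup n) M,
        (∀ w ∈ T, ∀ q : DoubleCoset.Quotient (decomp (K := K) w : Set (absoluteGaloisGroup K)) (κ.layerSubgroup n : Set (absoluteGaloisGroup K)),
          resOfLe M (inertiaIn_le_decompIn (κ.layerSubgroup n) w)
            (resH1Hom (decompInToH (κ.layerSubgroup n) w) (AddMonoidHom.id M) (fun _ _ ↦ rfl) (conjH1 (κ.layerSubgroup n) M q.out z) - τ w q) = 0) ∧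
        (∀ w : HeightOneSpectrum (𝓞 K), w ∉ T → (((p : ℕ) : 𝓞 K) ∉ w.asIdeal ∨ w = vbar) →
          ∀ σ : absoluteGaloisGroup K, conjH1 (κ.layerSubgroup n) M σ z ∈ unramifiedKer (κ.layerSubgroup n) M w)) :
    ∀ (T : Finset (HeightOneSpectrum (𝓞 K))), (∀ w ∈ T, ((p : ℕ) : 𝓞 K) ∉ w.asIdeal ∨ w = vbar) →
      ∀ τ : (w : HeightOneSpectrum (𝓞 K)) →
        DoubleCoset.Quotient (decomp (K := K) w : Set (absoluteGaloisGroup K)) (κ.layerSubgroup n : Set (absoluteGaloisGroup K)) →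
          subgroupH1 (decompIn (κ.layerSubgroup n) w) M,
      ∃ z : subgroupH1 (κ.layerSubgroup n) M,
        (∀ w ∈ T, ∀ q : DoubleCoset.Quotient (decomp (K := K) w : Set (absoluteGaloisGroup K)) (κ.layerSubgroup n : Set (absoluteGaloisGroup K)),
          resOfLe M (inertiaIn_le_decompIn (κ.layerSubgroup n) w)
            (resH1Hom (decompInToH (κ.layerSubgroup n) w) (AddMonoidHom.id M) (fun _ _ ↦ rfl) (conjH1 (κ.layerSubgroup n) M q.out z) - τ w q) = 0) ∧
        (∀ w : HeightOneSpectrum (𝓞 K), w ∉ T → (((p : ℕ) : 𝓞 K) ∉ w.asIdeal ∨ w = vbar) →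
          ∀ σ : absoluteGaloisGroup K, conjH1 (κ.layerSubgroup n) M σ z ∈ unramifiedKer (κ.layerSubgroup n) M w) := by
  refine locSurj_of_forall_torsionExponent (κ.layerSubgroup n) M ((κ.layerSubgroup n).isClosed_of_isOpen (κ.isOpen_layerSubgroup n)) htor
    (fun w hw ↦ ?_) hLSk
  obtain ⟨τ₀, hτ₀, hτ₀K⟩ := SetLike.not_le_iff_exists.mp (hD w hw)
  have hne : κ τ₀ ≠ 1 := fun h ↦ hτ₀K (ZpExtension.mem_kerSubgroup.2 h)
  exact LineDoubleCoset.finite_doubleCosetQuotient_layerSubgroup κ (decomp (K := K) w) (Coinv.isClosed_decomp w) hτ₀ hne n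

end Glue

end Summit.BirchSwinnertonDyer.BirchSwinnertonDyer.Theorems.PrintCf2.UpperBaseLift

end
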